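/-
Origin: expansion seat `planner-pub-hodgecm-pv14-g3-0`, handover #2 2026-08-18T05:32:33Z (`HOME/pub-hodgecm-pv14-g3/lean/Pv14g3/PerL34/P43KTypesU2Gen.lean`, md5 0aca3b7a, 325 lines);
landed by the gen-6 packager in gate run 23 as `HodgeCM/PerL34/P43_KTypesU2Gen.lean` (import ^import Pv14g3\.PerL34\.P43KTypesU2\b→import HodgeCM.PerL34.P43_KTypesU2 ×1).
-/
/-
Origin: HOME/pub-hodgecm-pv14-g3/lean/Pv14g3/PerL34/P43KTypesU2Gen.lean — session planner-pub-hodgecm-pv14-g3-0 (unit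
pub-hodgecm-pv14-g3, DAG-NODE PROVER #14 gen 3).  Intended final place: `HodgeCM/PerL34/P43_KTypesU2Gen.lean`, after
`P43_KTypesU2.lean` (this seat, step 1) and `P43_X1bridge.lean` (pv14, run 22).  On landing rewrite the import
`Pv14g3.PerL34.P43KTypesU2` ↦ `HodgeCM.PerL34.P43_KTypesU2`.  DAG node **N33b** (PerL v5 Prop 4.3 proof, step (C1) =
input (X1), tex ll. 650–652).  Nothing cited, nothing asserted.
-/
import Summits.HodgeConjecture.HodgeCM.PerL34.P43_KTypesU2
import Summits.HodgeConjecture.HodgeCM.PerL34.P43_X1bridge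

set_option autoImplicit false

/-!
# N33b (X1), concrete `K_{ι₁}`-types II: `𝔭₋ ⊗ 𝔭₊ ≅ Λ^{1,1}` is generated by `F_{0,0}`, `F_{1,1}`; `hgen` in the kernel

Continuation of `P43_KTypesU2.lean`.  The X1 bridge `P43X1Bridge.thetaPKilledByPminus_of_KTypes` has the leaf
`hgen : generatedBy R M₀ P ⊔ generatedBy R M₁ P = ⊤` — "`P = 𝔭₋ ⊗ Θ_i(χ'_i)[𝔭₊]` (diagonal `K_{ι₁}`-action) is
generated by the images of `F_{0,0}` and `F_{1,1}`", labelled PRINT ([BW VI 4.9(1),(2)]: `𝔭₋ ⊗ 𝔭₊ ≅ Λ^{1,1} =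
F_{0,0} ⊕ F_{1,1}`) + complete reducibility.  Here it becomes KERNEL + DEFINITIONAL:
* `pPlus`, `pMinus` : the `K`-modules `𝔭₊ ≅ ℂ²` (`(A,d)·v = d⁻¹ A v`) and `𝔭₋ ≅` its contragredient
  (`(A,d)·w = d Ā w`), `K = U(2) × U(1)` as in `P43_KTypesU2`;
* `outerEquiv : Representation.Equiv (pMinus.tprod pPlus) conjRep` — `w ⊗ v ↦ v wᵀ` is a `K`-isomorphism
  `𝔭₋ ⊗ 𝔭₊ ≅ M₂(ℂ)` (`= Λ^{1,1}`; bijective by a dimension count `2·2 = 4`);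
* `j00 : F00 → conjRep` (`c ↦ c·1`), `j11 : F11 → conjRep` (inclusion of `sl₂`), `range_j00_sup_range_j11 : ⊤`
  (`X = (tr X/2)·1 + (X - (tr X/2)·1)`) — i.e. [BW VI 4.9(1),(2)] for `n = 2`, `p = q = 1`:
  `Λ^{1,1} = F_{0,0} ⊕ F_{1,1}`, in the form the bridge consumes: `generatedBy_tprod`;
* ABSTRACT (any ring): `generatedBy` is functorial/transitive (`map_generatedBy_le`,
  `generatedBy_sup_eq_top_of_iSup_range`);
* **`hgen_of_pPlusIsotypic`**: for EVERY `K`-module `Q` that is `𝔭₊`-isotypic in the sense of the bridge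
  (`generatedBy ℂ[K] 𝔭₊ Q = ⊤` — DEFINITIONAL for `Q = Θ_i(χ'_i)[𝔭₊]`, "the subspace spanned by the `θ(φ,χ'_i)`
  with `φ` of `K_∞`-type `𝔭₊ ⊠ 𝟏`", tex l. 646), the diagonal `K`-module `𝔭₋ ⊗ Q` satisfies `hgen` with
  `M₀ = F00.asModule`, `M₁ = F11.asModule` (both simple by `P43_KTypesU2`);
* `thetaPKilledByPminus_of_U2` : the bridge with these leaves plugged in BY NAME — the remaining hypotheses are
  exactly `h₀ h₁` (PRINT [BW VI 4.11/(9)] + INPUT N31: `F_{0,0}`, `F_{1,1}` do not occur in the `(𝔤,K)`-module of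
  `Θ_i(χ'_i)`), `act`/`hdict`/`hCoch` (DEFINITIONAL dictionary) and `hQ` (DEFINITIONAL).
-/

noncomputable section

namespace HodgeCM
namespace PerL34
namespace P43KTypesU2

open Matrix Complex TensorProduct P43KTypes P43X1Bridge

/-! ## Abstract: functoriality / transitivity of `generatedBy` (any ring) -/

section Abstract

variable {R : Type*} [Ring R] {M M₀ M₁ A P : Type*} [AddCommGroup M] [Module R M]
  [AddCommGroup M₀] [Module R M₀] [AddCommGroup M₁] [Module R M₁]
  [AddCommGroup A] [Module R A] [AddCommGroup P] [Module R P]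

/-- The `M`-generated part is functorial: `g (⟨images of M in A⟩) ≤ ⟨images of M in P⟩`. -/
theorem map_generatedBy_le (g : A →ₗ[R] P) : (generatedBy R M A).map g ≤ generatedBy R M P := by
  unfold generatedBy
  rw [Submodule.map_iSup]
  refine iSup_le fun f => ?_
  rw [← LinearMap.range_comp]
  exact le_iSup (fun h : M →ₗ[R] P => LinearMap.range h) (g.comp f)

/-- Two maps `M₀ → A`, `M₁ → A` whose ranges span `A` exhibit `A` as generated by `M₀` and `M₁`. -/
theorem generatedBy_sup_eq_top_of_ranges (j₀ : M₀ →ₗ[R] A) (j₁ : M₁ →ₗ[R] A)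
    (h : LinearMap.range j₀ ⊔ LinearMap.range j₁ = ⊤) :
    generatedBy R M₀ A ⊔ generatedBy R M₁ A = ⊤ := by
  rw [eq_top_iff, ← h]
  exact sup_le_sup (le_iSup (fun f : M₀ →ₗ[R] A => LinearMap.range f) j₀)
    (le_iSup (fun f : M₁ →ₗ[R] A => LinearMap.range f) j₁)

/-- Transitivity: if `P` is generated by images of `A` and `A` by images of `M₀`, `M₁`, then `P` is generated by
images of `M₀`, `M₁`. -/
theorem generatedBy_sup_eq_top_of_iSup_range {ι : Type*} (g : ι → (A →ₗ[R] P))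
    (hg : ⨆ i, LinearMap.range (g i) = ⊤) (hA : generatedBy R M₀ A ⊔ generatedBy R M₁ A = ⊤) :
    generatedBy R M₀ P ⊔ generatedBy R M₁ P = ⊤ := by
  rw [eq_top_iff, ← hg]
  refine iSup_le fun i => ?_
  rw [LinearMap.range_eq_map, ← hA, Submodule.map_sup]
  exact sup_le_sup (map_generatedBy_le (g i)) (map_generatedBy_le (g i))

end Abstract

/-! ## `𝔭₊`, `𝔭₋` and `𝔭₋ ⊗ 𝔭₊ ≅ M₂(ℂ) = Λ^{1,1}` -/

/-- The entrywise conjugate `Ā` of the `U(2)`-component of `k = (A,d)`. -/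
abbrev cmat (k : K) : Matrix (Fin 2) (Fin 2) ℂ := (star (mat k))ᵀ

/-- `𝔭₊ ≅ ℂ²` (`= Hom(V₋, V₊)` for `U(2,1) ⊃ U(2) × U(1)`): `(A,d)·v = d⁻¹ A v`, `d⁻¹ = d̄`. -/
def pPlus : Representation ℂ K (Fin 2 → ℂ) where
  toFun k :=
    { toFun := fun v => star (k.2 : ℂ) • (mat k).mulVec v
      map_add' := fun v w => by rw [Matrix.mulVec_add, smul_add]
      map_smul' := fun c v => by rw [Matrix.mulVec_smul, smul_comm, RingHom.id_apply] }
  map_one' := by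
    apply LinearMap.ext
    intro v
    simp [mat]
  map_mul' k₁ k₂ := by
    apply LinearMap.ext
    intro v
    simp only [mat, Prod.fst_mul, Prod.snd_mul, Submonoid.coe_mul, LinearMap.coe_mk, AddHom.coe_mk,
      Module.End.mul_apply, Matrix.mulVec_smul, ← Matrix.mulVec_mulVec, smul_smul, star_mul']

/-- (Ported verbatim from the HodgeCMPerL package; no docstring in the source.) -/
@[simp] theorem pPlus_apply (k : K) (v : Fin 2 → ℂ) : pPlus k v = star (k.2 : ℂ) • (mat k).mulVec v := rfl

/-- `𝔭₋ ≅ (ℂ²)^*`, the contragredient of `𝔭₊` (`= Hom(V₊, V₋)`): `(A,d)·w = d Ā w` (row vector `w ↦ d·wA*`). -/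
def pMinus : Representation ℂ K (Fin 2 → ℂ) where
  toFun k :=
    { toFun := fun w => (k.2 : ℂ) • (cmat k).mulVec w
      map_add' := fun v w => by rw [Matrix.mulVec_add, smul_add]
      map_smul' := fun c v => by rw [Matrix.mulVec_smul, smul_comm, RingHom.id_apply] }
  map_one' := by
    apply LinearMap.ext
    intro v
    simp [cmat, mat]
  map_mul' k₁ k₂ := by
    apply LinearMap.ext
    intro v
    simp only [cmat, mat, Prod.fst_mul, Prod.snd_mul, Submonoid.coe_mul, LinearMap.coe_mk, AddHom.coe_mk,
      Module.End.mul_apply, Matrix.mulVec_smul, ← Matrix.mulVec_mulVec, smul_smul, star_mul,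
      Matrix.transpose_mul]

/-- (Ported verbatim from the HodgeCMPerL package; no docstring in the source.) -/
@[simp] theorem pMinus_apply (k : K) (w : Fin 2 → ℂ) : pMinus k w = (k.2 : ℂ) • (cmat k).mulVec w := rfl

/-- The pairing `⟨w, v⟩ = Σ wᵢ vᵢ` is `K`-invariant: `𝔭₋` is the contragredient of `𝔭₊`. -/
theorem pairing_invariant (k : K) (w v : Fin 2 → ℂ) :
    dotProduct (pMinus k w) (pPlus k v) = dotProduct w v := by
  rw [pMinus_apply, pPlus_apply, dotProduct_smul, smul_dotProduct, smul_smul, Matrix.dotProduct_mulVec,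
    Matrix.vecMul_mulVec, cmat, Matrix.transpose_transpose, star_mul_mat, Matrix.vecMul_one,
    Unitary.star_mul_self_of_mem k.2.2, one_smul]

/-- `w ⊗ v ↦ v wᵀ` : `𝔭₋ ⊗ 𝔭₊ → M₂(ℂ)`, `(v wᵀ)_{ij} = vᵢ wⱼ`. -/
def outerLin : ((Fin 2 → ℂ) ⊗[ℂ] (Fin 2 → ℂ)) →ₗ[ℂ] Matrix (Fin 2) (Fin 2) ℂ :=
  TensorProduct.lift (LinearMap.mk₂ ℂ (fun w v => vecMulVec v w)
    (fun w₁ w₂ v => by simp only [vecMulVec_add])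
    (fun c w v => by simp only [vecMulVec_smul])
    (fun w v₁ v₂ => by simp only [add_vecMulVec])
    (fun c w v => by simp only [smul_vecMulVec]))

/-- (Ported verbatim from the HodgeCMPerL package; no docstring in the source.) -/
@[simp] theorem outerLin_tmul (w v : Fin 2 → ℂ) : outerLin (w ⊗ₜ v) = vecMulVec v w := by
  simp [outerLin]

/-- (Ported verbatim from the HodgeCMPerL package; no docstring in the source.) -/
theorem vecMulVec_mulVec (M N : Matrix (Fin 2) (Fin 2) ℂ) (v w : Fin 2 → ℂ) :
    vecMulVec (M.mulVec v) (N.mulVec w) = M * vecMulVec v w * Nᵀ := by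
  ext i j
  fin_cases i <;> fin_cases j <;> simp [vecMulVec_apply, Matrix.mul_apply, Fin.sum_univ_two] <;> ring

/-- Equivariance of `outerLin` on pure tensors: `(d⁻¹Av)(dĀw)ᵀ = A (v wᵀ) A*`. -/
theorem outerLin_equivariant (k : K) (w v : Fin 2 → ℂ) :
    outerLin (pMinus k w ⊗ₜ pPlus k v) = conjRep k (outerLin (w ⊗ₜ v)) := by
  rw [outerLin_tmul, outerLin_tmul, pMinus_apply, pPlus_apply, conjRep_apply, smul_vecMulVec, vecMulVec_smul,
    smul_smul, Unitary.star_mul_self_of_mem k.2.2, one_smul, vecMulVec_mulVec, cmat, Matrix.transpose_transpose]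

/-- (Ported verbatim from the HodgeCMPerL package; no docstring in the source.) -/
theorem outerLin_surjective : Function.Surjective outerLin := by
  intro X
  refine ⟨(Pi.single 0 1) ⊗ₜ (fun i => X i 0) + (Pi.single 1 1) ⊗ₜ (fun i => X i 1), ?_⟩
  rw [map_add, outerLin_tmul, outerLin_tmul]
  ext i j
  fin_cases i <;> fin_cases j <;> simp [vecMulVec_apply]

/-- (Ported verbatim from the HodgeCMPerL package; no docstring in the source.) -/
theorem outerLin_bijective : Function.Bijective outerLin := by
  have hdim : Module.finrank ℂ ((Fin 2 → ℂ) ⊗[ℂ] (Fin 2 → ℂ)) = Module.finrank ℂ (Matrix (Fin 2) (Fin 2) ℂ) := by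
    simp [Module.finrank_tensorProduct, Module.finrank_matrix]
  exact ⟨(LinearMap.injective_iff_surjective_of_finrank_eq_finrank hdim).mpr outerLin_surjective,
    outerLin_surjective⟩

/-- **[BW VI 4.9] for `n = 2`, `p = q = 1`, matrix form:** `𝔭₋ ⊗ 𝔭₊ ≅ M₂(ℂ)` (`= End 𝔭₊ = Λ^{1,1}`) as
`K_{ι₁}`-modules, via `w ⊗ v ↦ v wᵀ`. -/
def outerEquiv : Representation.Equiv (pMinus.tprod pPlus) conjRep :=
  Representation.Equiv.mk (LinearEquiv.ofBijective outerLin outerLin_bijective) (fun k => by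
    apply TensorProduct.ext'
    intro w v
    simp only [LinearMap.comp_apply, LinearEquiv.coe_coe, LinearEquiv.ofBijective_apply,
      Representation.tprod_apply, TensorProduct.map_tmul]
    exact outerLin_equivariant k w v)

/-- (Ported verbatim from the HodgeCMPerL package; no docstring in the source.) -/
theorem outerEquiv_apply (z : (Fin 2 → ℂ) ⊗[ℂ] (Fin 2 → ℂ)) : outerEquiv z = outerLin z := rfl

/-- `F_{0,0} ↪ Λ^{1,1}`: the scalar matrices. -/
def j00 : Representation.IntertwiningMap F00 conjRep where
  toLinearMap := LinearMap.toSpanSingleton ℂ (Matrix (Fin 2) (Fin 2) ℂ) 1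
  isIntertwining' k := by
    apply LinearMap.ext
    intro c
    simp only [LinearMap.comp_apply, LinearMap.toSpanSingleton_apply, F00, Representation.trivial_apply,
      conjRep_apply, Matrix.mul_smul, Matrix.mul_one, Matrix.smul_mul, mat_mul_star]

/-- (Ported verbatim from the HodgeCMPerL package; no docstring in the source.) -/
@[simp] theorem j00_apply (c : ℂ) : j00 c = c • (1 : Matrix (Fin 2) (Fin 2) ℂ) := rfl

/-- `F_{1,1} ↪ Λ^{1,1}`: the traceless matrices. -/
def j11 : Representation.IntertwiningMap F11 conjRep where
  toLinearMap := V11.subtype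
  isIntertwining' k := by
    apply LinearMap.ext
    intro v
    rfl

/-- (Ported verbatim from the HodgeCMPerL package; no docstring in the source.) -/
@[simp] theorem j11_apply (v : V11) : j11 v = (v : Matrix (Fin 2) (Fin 2) ℂ) := rfl

/-- (Ported verbatim from the HodgeCMPerL package; no docstring in the source.) -/
theorem traceless_part_mem (X : Matrix (Fin 2) (Fin 2) ℂ) : X - (X.trace / 2) • (1 : Matrix (Fin 2) (Fin 2) ℂ) ∈ V11 := by
  rw [mem_V11, Matrix.trace_sub, Matrix.trace_smul, Matrix.trace_one, Fintype.card_fin, smul_eq_mul]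
  push_cast
  ring

/-- `M₂(ℂ) = ℂ·1 ⊕ sl₂(ℂ)`: `X = (tr X / 2)·1 + (X - (tr X / 2)·1)` — [BW VI 4.9(1),(2)] `Λ^{1,1} = F_{0,0} ⊕ F_{1,1}`. -/
theorem range_j00_sup_range_j11 :
    LinearMap.range j00.toLinearMap ⊔ LinearMap.range j11.toLinearMap = ⊤ := by
  rw [eq_top_iff]
  rintro X -
  have hX : X = (X.trace / 2) • (1 : Matrix (Fin 2) (Fin 2) ℂ) + (X - (X.trace / 2) • 1) := by rw [add_sub_cancel]
  rw [hX]
  exact Submodule.add_mem _ (Submodule.mem_sup_left ⟨X.trace / 2, rfl⟩)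
    (Submodule.mem_sup_right ⟨⟨_, traceless_part_mem X⟩, rfl⟩)

/-! ## As `ℂ[K]`-modules: `generatedBy` -/

/-- `Λ^{1,1} = 𝔭₋ ⊗ 𝔭₊` is generated by the images of `F_{0,0}` and `F_{1,1}`, as `ℂ[K_{ι₁}]`-modules. -/
theorem generatedBy_tprod :
    generatedBy (MonoidAlgebra ℂ K) F00.asModule (pMinus.tprod pPlus).asModule ⊔
      generatedBy (MonoidAlgebra ℂ K) F11.asModule (pMinus.tprod pPlus).asModule = ⊤ := by
  let e : Representation.Equiv conjRep (pMinus.tprod pPlus) := outerEquiv.symm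
  let g₀ : F00.asModule →ₗ[MonoidAlgebra ℂ K] (pMinus.tprod pPlus).asModule :=
    Representation.IntertwiningMap.equivLinearMapAsModule F00 (pMinus.tprod pPlus) (e.toIntertwiningMap.comp j00)
  let g₁ : F11.asModule →ₗ[MonoidAlgebra ℂ K] (pMinus.tprod pPlus).asModule :=
    Representation.IntertwiningMap.equivLinearMapAsModule F11 (pMinus.tprod pPlus) (e.toIntertwiningMap.comp j11)
  apply generatedBy_sup_eq_top_of_ranges g₀ g₁
  rw [eq_top_iff]
  rintro z -
  have key : ∀ X : Matrix (Fin 2) (Fin 2) ℂ,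
      (show (pMinus.tprod pPlus).asModule from e.toLinearEquiv X) ∈ LinearMap.range g₀ ⊔ LinearMap.range g₁ := by
    intro X
    have hX : X = (X.trace / 2) • (1 : Matrix (Fin 2) (Fin 2) ℂ) + (X - (X.trace / 2) • 1) := by
      rw [add_sub_cancel]
    have h0 : g₀ (show F00.asModule from X.trace / 2) =
        (show (pMinus.tprod pPlus).asModule from e.toLinearEquiv ((X.trace / 2) • (1 : Matrix (Fin 2) (Fin 2) ℂ))) :=
      rfl
    have h1 : g₁ (show F11.asModule from (⟨_, traceless_part_mem X⟩ : V11)) =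
        (show (pMinus.tprod pPlus).asModule from e.toLinearEquiv (X - (X.trace / 2) • 1)) := rfl
    have m0 : (show (pMinus.tprod pPlus).asModule from
        e.toLinearEquiv ((X.trace / 2) • (1 : Matrix (Fin 2) (Fin 2) ℂ))) ∈ LinearMap.range g₀ := by
      rw [← h0]; exact LinearMap.mem_range_self g₀ _
    have m1 : (show (pMinus.tprod pPlus).asModule from e.toLinearEquiv (X - (X.trace / 2) • 1)) ∈
        LinearMap.range g₁ := by
      rw [← h1]; exact LinearMap.mem_range_self g₁ _
    rw [hX, map_add]
    exact Submodule.add_mem _ (Submodule.mem_sup_left m0) (Submodule.mem_sup_right m1)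
  have hz : (show (pMinus.tprod pPlus).asModule from
      e.toLinearEquiv (outerLin (show (Fin 2 → ℂ) ⊗[ℂ] (Fin 2 → ℂ) from z))) = z :=
    outerEquiv.symm_apply_apply (show (Fin 2 → ℂ) ⊗[ℂ] (Fin 2 → ℂ) from z)
  rw [← hz]
  exact key _

/-- **`hgen` of the X1 bridge, in the kernel.**  For every `K_{ι₁}`-module `Q` generated by images of `𝔭₊`
(`= Θ_i(χ'_i)[𝔭₊]` is `𝔭₊`-isotypic — DEFINITIONAL, tex l. 646), the diagonal `K_{ι₁}`-module `𝔭₋ ⊗ Q` is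
generated by the images of `F_{0,0}` and `F_{1,1}`. -/
theorem hgen_of_pPlusIsotypic {Q : Type*} [AddCommGroup Q] [Module ℂ Q] (σ : Representation ℂ K Q)
    (hQ : generatedBy (MonoidAlgebra ℂ K) pPlus.asModule σ.asModule = ⊤) :
    generatedBy (MonoidAlgebra ℂ K) F00.asModule (pMinus.tprod σ).asModule ⊔
      generatedBy (MonoidAlgebra ℂ K) F11.asModule (pMinus.tprod σ).asModule = ⊤ := by
  -- the family `w ⊗ v ↦ w ⊗ f v`, `f : 𝔭₊ → Q` equivariant
  let L : (pPlus.asModule →ₗ[MonoidAlgebra ℂ K] σ.asModule) →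
      ((pMinus.tprod pPlus).asModule →ₗ[MonoidAlgebra ℂ K] (pMinus.tprod σ).asModule) := fun f =>
    Representation.IntertwiningMap.equivLinearMapAsModule (pMinus.tprod pPlus) (pMinus.tprod σ)
      (((Representation.IntertwiningMap.equivLinearMapAsModule pPlus σ).symm f).lTensor pMinus)
  refine generatedBy_sup_eq_top_of_iSup_range L ?_ generatedBy_tprod
  rw [eq_top_iff]
  rintro z -
  have pure : ∀ (w : Fin 2 → ℂ) (q : Q),
      (show (pMinus.tprod σ).asModule from w ⊗ₜ[ℂ] q) ∈ ⨆ f, LinearMap.range (L f) := by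
    intro w q
    have hq : (show σ.asModule from q) ∈ generatedBy (MonoidAlgebra ℂ K) pPlus.asModule σ.asModule := by
      rw [hQ]; exact Submodule.mem_top
    refine Submodule.iSup_induction (fun f : pPlus.asModule →ₗ[MonoidAlgebra ℂ K] σ.asModule => LinearMap.range f)
      (motive := fun q' : σ.asModule =>
        (show (pMinus.tprod σ).asModule from w ⊗ₜ[ℂ] (show Q from q')) ∈ ⨆ f, LinearMap.range (L f))
      hq ?_ ?_ ?_
    · rintro f q' ⟨v, rfl⟩
      refine Submodule.mem_iSup_of_mem f ⟨(show (pMinus.tprod pPlus).asModule from w ⊗ₜ[ℂ] (show (Fin 2 → ℂ) from v)), ?_⟩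
      rfl
    · have : (show (pMinus.tprod σ).asModule from w ⊗ₜ[ℂ] (show Q from (0 : σ.asModule))) = 0 :=
        TensorProduct.tmul_zero _ w
      rw [this]
      exact Submodule.zero_mem _
    · intro q₁ q₂ h₁ h₂
      have : (show (pMinus.tprod σ).asModule from w ⊗ₜ[ℂ] (show Q from (q₁ + q₂))) =
          (show (pMinus.tprod σ).asModule from w ⊗ₜ[ℂ] (show Q from q₁)) +
            (show (pMinus.tprod σ).asModule from w ⊗ₜ[ℂ] (show Q from q₂)) :=
        TensorProduct.tmul_add w _ _
      rw [this]
      exact Submodule.add_mem _ h₁ h₂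
  induction (show (Fin 2 → ℂ) ⊗[ℂ] Q from z) using TensorProduct.induction_on with
  | zero => exact Submodule.zero_mem _
  | tmul w q => exact pure w q
  | add x y hx hy => exact Submodule.add_mem _ hx hy

/-! ## The X1 bridge with the concrete `K`-type leaves plugged in -/

section Bridge

variable {Ginf Gc Gf V S : Type*} [Group Gc] [Group Gf] [AddCommGroup V] [Module ℂ V]
  [AddCommGroup S] [Module ℂ S]
  (D : P43Forms.FormsDictionary Ginf V) (M : P43Forms.ThetaKernelData Ginf Gc Gf V S)

/-- **(X1) `ThetaPKilledByPminus` for `K_{ι₁} = U(2) × U(1)`**, from: `hQ` — the `K_{ι₁}`-module `Q`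
(`= Θ_i(χ'_i)[𝔭₊]`) is `𝔭₊`-isotypic (DEFINITIONAL); `h₀ h₁` — neither `F_{0,0}` nor `F_{1,1}` occurs in `N`
(`=` the `(𝔤,K)`-module generated by `Θ_i(χ'_i)`; PRINT [BW VI 4.11/(9)] + INPUT N31); `act`, `hdict`, `hCoch` —
the DEFINITIONAL dictionary of `P43_X1bridge` with `P = 𝔭₋ ⊗ Q`.  Simplicity of `F_{0,0}`, `F_{1,1}` and `hgen`
are now supplied by the kernel (`P43_KTypesU2`, this file). -/
theorem thetaPKilledByPminus_of_U2 {Q : Type*} [AddCommGroup Q] [Module ℂ Q] (σ : Representation ℂ K Q)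
    (hQ : generatedBy (MonoidAlgebra ℂ K) pPlus.asModule σ.asModule = ⊤)
    {N : Type*} [AddCommGroup N] [Module (MonoidAlgebra ℂ K) N]
    (h₀ : NoEmbedding (MonoidAlgebra ℂ K) F00.asModule N) (h₁ : NoEmbedding (MonoidAlgebra ℂ K) F11.asModule N)
    (act : (pMinus.tprod σ).asModule →ₗ[MonoidAlgebra ℂ K] N) (ι : N →+ (Ginf → V))
    (hdict : ∀ X ∈ D.Pminus, ∀ φ ∈ M.Ptype, ∃ p : (pMinus.tprod σ).asModule,
      X (P43Forms.uEval (M.theta φ)) = ι (act p))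
    (hCoch : ∀ φ ∈ M.Ptype, P43Forms.uEval (M.theta φ) ∈ D.Cochain) :
    P43Forms.ThetaPKilledByPminus D M :=
  thetaPKilledByPminus_of_KTypes D M h₀ h₁ (hgen_of_pPlusIsotypic σ hQ) act ι hdict hCoch

end Bridge

end P43KTypesU2
end PerL34
end HodgeCM

end
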